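import Mathlib
import Summits.Ventures.PercRepro2.LocRows
import Summits.Ventures.PercRepro2.SwRow
import Summits.Ventures.PercRepro2.SwOut
import Summits.Ventures.PercRepro2.SwAllRow
import Summits.Ventures.PercRepro2.SwOutAll
import Summits.Ventures.PercRepro2.SwOutArmFlip
import Summits.Ventures.PercRepro2.SwOutArmThm
import Summits.Ventures.PercRepro2.SwOutJunction
import Summits.Ventures.PercRepro2.SwOutJunctionRegion
import Summits.Ventures.PercRepro2.SwOutCoreDefs
import Summits.Ventures.PercRepro2.SwOutCoreKey
import Summits.Ventures.PercRepro2.SwOutJunctionH1Defs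
import Summits.Ventures.PercRepro2.SwOutJunctionH1Arms
import Summits.Ventures.PercRepro2.SwOutJunctionH1Cover
import Summits.Ventures.PercRepro2.SwOutJunctionH1Inside
import Summits.Ventures.PercRepro2.SwOutJunctionH1Base
import Summits.Ventures.PercRepro2.SwOutJunctionH1Kinds
import Summits.Ventures.PercRepro2.SwOutBigBlockDefs
import Summits.Ventures.PercRepro2.SwOutMixedBaseDefs

/-!
# The mixed single junction: vocabulary and inside connectivity (blind cell PercRepro2, night-4
g19, 2026-08-27; proofs/NIGHT4-G19.md §1)

THE PARTITION of a single-junction class with a single-vertex mixed dropped piece (NIGHT4-G18.md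
§6–§7) extends Theorem A (`rigidOK_of_junctionH1`) by a fourth kind whose block is the block
`blockC` of a `MixedBase` (`MixedBase.rigid_block`).  This file: the vocabulary.

THE MIXED SINGLE JUNCTION (H1_mix) at `(u, p)` (`MixedJunction`): the junction `u ∈ U ∖ {h, o}`
(no loop, not adjacent to `h`) and the DROPPED VERTEX `p ∈ U ∖ {h, o, u}` adjacent to `u`, not
adjacent to `h`, without a loop; (a) every neighbour of `u` other than `p` is adjacent to `h`;
(b) every neighbour of `p` inside `U` other than `u` is adjacent to `h`; (d) the component of `p`
in `G[U ∖ {h, u}]` contains no neighbour of `u` other than `p`; (e) `p` has a neighbour inside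
`U` other than `u`; and every other vertex of `U ∖ {h, o}` carries an outside edge or no edge.
The simple-arm hypothesis (H1) FAILS at `p` on every such graph.

For a configuration `ζ` the arm of `p` (`armC ζ p`) is the MIXED ARM `Ah ∪ {p}` with the h-piece
`AhOf ζ = armC ζ p ∖ {p}`; the other arms are the u-arms (`uArms`, adjacent to `u`) and the far
arms (`farArms`); `qOf ζ` is the raw-cube point read off the red side.  Inside connectivity on
the red side: `harm_conn_red'` (an h-arm whose u-neighbours are h-adjacent — (a) for the u-arms,
vacuous for the far arms) and `Ah_conn_red` (the h-piece: the only ways into it from outside are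
`h`, the dead edges and the u-edges, and the last two are excluded).  Also `coreBaseOf_bdry_blue`
(the canonical base is blue on every edge leaving the extended hull), `p_mem_extHull`,
`armP_mem_armsC`, `arm_cases` (every vertex of `H⁺ ∖ {h, u}` is in the h-piece, is `p`, or lies in
a u-arm or a far arm) and `eq_p_of_u_edge` ((d) at the arm of `p`).
-/

namespace Summit.Ventures.PercRepro2

namespace BigBlock

open Hull LocRows

variable {V : Type*} {E : Type*} [Fintype E] [DecidableEq E]

open scoped Classical

variable {ends : E → Sym2 V}

section Vocabulary

variable (ends) (h u p : V)

/-- The h-piece of the mixed arm: the arm of `p` without `p`. -/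
noncomputable def AhOf (ζ : Config E) : Set V := armC ends h u ζ p \ {p}

/-- The u-arms: the arms other than the arm of `p` that are adjacent to `u`. -/
noncomputable def uArms (ζ : Config E) : Finset (Set V) :=
  (armsC ends h u ζ).filter fun P => P ≠ armC ends h u ζ p ∧ ∃ e x, ends e = s(u, x) ∧ x ∈ P

/-- The far arms: the arms other than the arm of `p` that are not adjacent to `u`. -/
noncomputable def farArms (ζ : Config E) : Finset (Set V) :=
  (armsC ends h u ζ).filter fun P => P ≠ armC ends h u ζ p ∧ ¬ ∃ e x, ends e = s(u, x) ∧ x ∈ P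

/-- The raw-cube point of a core-kind configuration: the arms on its red side (the mixed arm
gives the three coordinates `a = uP = e`). -/
noncomputable def qOf (ζ : Config E) : Pt (uArms ends h u p ζ) (farArms ends h u p ζ) :=
  (fun P => decide (P.1 ⊆ redExt ends h u ζ),
    decide (armC ends h u ζ p ⊆ redExt ends h u ζ),
    decide (armC ends h u ζ p ⊆ redExt ends h u ζ),
    decide (armC ends h u ζ p ⊆ redExt ends h u ζ),
    fun P => decide (P.1 ⊆ redExt ends h u ζ))

/-- **The mixed single junction (H1_mix)**: the junction `u` and the dropped vertex `p`. -/
structure MixedJunction (ends : E → Sym2 V) (U : Set V) (h u p o : V) : Prop where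
  hne_hu : h ≠ u
  hne_hp : h ≠ p
  hne_up : u ≠ p
  hou : o ≠ u
  hop : o ≠ p
  hloop_h : ∀ e, ends e ≠ s(h, h)
  hloop_u : ∀ e, ends e ≠ s(u, u)
  hloop_p : ∀ e, ends e ≠ s(p, p)
  hnadj : ∀ e, ends e ≠ s(h, u)
  hnadj_p : ∀ e, ends e ≠ s(h, p)
  hup : ∃ e, ends e = s(u, p)
  /-- (a) every neighbour of `u` other than `p` is adjacent to `h`. -/
  hu_adj_h : ∀ e x, ends e = s(u, x) → x ≠ p → ∃ e', ends e' = s(x, h)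
  /-- (b) every neighbour of `p` inside `U` other than `u` is adjacent to `h`. -/
  hp_adj_h : ∀ e x, ends e = s(p, x) → x ∈ U → x ≠ u → ∃ e', ends e' = s(x, h)
  /-- (d) the component of `p` in `G[U ∖ {h, u}]` has no neighbour of `u` other than `p`. -/
  hcomp : ∀ x ∈ compU ends U h u p, x ≠ p → ∀ e, ends e ≠ s(u, x)
  /-- (e) `p` has a neighbour inside `U` other than `u`. -/
  hp_nbr : ∃ e x, ends e = s(p, x) ∧ x ∈ U ∧ x ≠ u
  hout : ∀ x ∈ U, x ≠ h → x ≠ o → x ≠ u →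
    (∃ e y, ends e = s(x, y) ∧ y ∉ U) ∨ (∀ e, x ∉ ends e)

end Vocabulary

section Inside

variable {h u p : V} {η : Config E}

omit [DecidableEq E] in
/-- **Inside connectivity of an h-arm on the red side** whose u-neighbours are adjacent to `h`
(the sides disjoint). -/
theorem harm_conn_red'
    (hdisj : ∀ x, x ∈ redExt ends h u η → x ∈ blueExt ends η h u → False)
    {P : Set V} (hP : P ∈ armsC ends h u η) (hPR : P ⊆ redExt ends h u η)
    (hPu : ∀ e x, ends e = s(u, x) → x ∈ P → ∃ e', ends e' = s(x, h)) :
    ∀ x ∈ P, x ∈ cluster ends (insideConfig ends (P ∪ {h}) η) h := by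
  have hPsub := armsC_subset hP
  have hhP : h ∉ P := fun hh => (hPsub h hh).2.1 rfl
  have huP : u ∉ P := fun hu => (hPsub u hu).2.2 rfl
  let S : Set V := {v | v ∉ P ∨ v ∈ cluster ends (insideConfig ends (P ∪ {h}) η) h}
  have hclosed : ∀ a ∈ S, ∀ b, (openGraph ends η).Adj a b → b ∈ S := by
    intro a ha b hab
    obtain ⟨_, e, he, hends⟩ := openGraph_adj.1 hab
    by_cases hbP : b ∈ P
    · right
      by_cases haP : a ∈ P
      · have hin : insideConfig ends (P ∪ {h}) η e = true :=
          insideConfig_eq_true_iff.2 ⟨he, a, Or.inl haP, b, Or.inl hbP, hends⟩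
        rcases ha with ha | ha
        · exact absurd haP ha
        · exact mem_cluster_of_edge ha hin hends
      by_cases hah : a = h
      · rw [hah] at hends
        have hin : insideConfig ends (P ∪ {h}) η e = true :=
          insideConfig_eq_true_iff.2 ⟨he, h, Or.inr rfl, b, Or.inl hbP, hends⟩
        exact mem_cluster_of_edge (mem_cluster_self _ _ _) hin hends
      by_cases hau : a = u
      · rw [hau] at hends
        obtain ⟨e', he'⟩ := hPu e b hends hbP
        have hred : η e' = true := by
          by_contra hblue
          simp only [Bool.not_eq_true] at hblue
          have hb' : blue η e' = true := by rw [blue_eq_true_iff]; exact hblue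
          have hbB : b ∈ blueExt ends η h u := by
            rw [mem_blueExt_iff]
            exact ⟨Or.inl (mem_cluster_of_edge (mem_cluster_self _ _ _) hb' (ends_swap he')),
              (hPsub b hbP).2.1, (hPsub b hbP).2.2⟩
          exact hdisj b (hPR hbP) hbB
        have hin : insideConfig ends (P ∪ {h}) η e' = true :=
          insideConfig_eq_true_iff.2 ⟨hred, h, Or.inr rfl, b, Or.inl hbP, ends_swap he'⟩
        exact mem_cluster_of_edge (mem_cluster_self _ _ _) hin (ends_swap he')
      · exact absurd (mem_armsC_of_red_edge hP hPR hends hbP he hah hau) haP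
    · exact Or.inl hbP
  intro x hx
  have hxR := hPR hx
  rw [mem_redExt_iff] at hxR
  have hxS : x ∈ S := by
    rcases hxR.1 with hx' | hx'
    · exact mem_of_conn_of_closed hclosed (Or.inl hhP) hx'
    · exact mem_of_conn_of_closed hclosed (Or.inl huP) hx'
  rcases hxS with h' | h'
  · exact absurd hx h'
  · exact h'

omit [DecidableEq E] in
/-- **Inside connectivity of the h-piece on the red side**: when the arm of `p` lies on the red
side, no u-edge enters it except at `p`, and the dead edges are blue, every vertex of the h-piece
is red-connected to `h` inside the h-piece with `h`. -/
theorem Ah_conn_red (hP : armC ends h u η p ∈ armsC ends h u η)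
    (hPR : armC ends h u η p ⊆ redExt ends h u η)
    (hno_u : ∀ e x, ends e = s(u, x) → x ∈ armC ends h u η p → x = p)
    (hdead : ∀ e x, ends e = s(p, x) → x ∈ armC ends h u η p → x ≠ p → η e = false) :
    ∀ x ∈ armC ends h u η p \ {p},
      x ∈ cluster ends (insideConfig ends ((armC ends h u η p \ {p}) ∪ {h}) η) h := by
  set A := armC ends h u η p \ {p} with hA
  have hPsub := armsC_subset hP
  have hhA : h ∉ A := fun hh => (hPsub h hh.1).2.1 rfl
  have huA : u ∉ A := fun hu => (hPsub u hu.1).2.2 rfl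
  let S : Set V := {v | v ∉ A ∨ v ∈ cluster ends (insideConfig ends (A ∪ {h}) η) h}
  have hclosed : ∀ a ∈ S, ∀ b, (openGraph ends η).Adj a b → b ∈ S := by
    intro a ha b hab
    obtain ⟨_, e, he, hends⟩ := openGraph_adj.1 hab
    by_cases hbA : b ∈ A
    · right
      by_cases haA : a ∈ A
      · have hin : insideConfig ends (A ∪ {h}) η e = true :=
          insideConfig_eq_true_iff.2 ⟨he, a, Or.inl haA, b, Or.inl hbA, hends⟩
        rcases ha with ha | ha
        · exact absurd haA ha
        · exact mem_cluster_of_edge ha hin hends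
      by_cases hah : a = h
      · rw [hah] at hends
        have hin : insideConfig ends (A ∪ {h}) η e = true :=
          insideConfig_eq_true_iff.2 ⟨he, h, Or.inr rfl, b, Or.inl hbA, hends⟩
        exact mem_cluster_of_edge (mem_cluster_self _ _ _) hin hends
      by_cases hau : a = u
      · exfalso
        rw [hau] at hends
        exact hbA.2 (hno_u e b hends hbA.1)
      by_cases hap : a = p
      · exfalso
        rw [hap] at hends
        have := hdead e b hends hbA.1 hbA.2
        rw [he] at this
        exact Bool.noConfusion this
      · exfalso
        have haP : a ∈ armC ends h u η p := mem_armsC_of_red_edge hP hPR hends hbA.1 he hah hau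
        exact haA ⟨haP, hap⟩
    · exact Or.inl hbA
  intro x hx
  have hxR := hPR hx.1
  rw [mem_redExt_iff] at hxR
  have hxS : x ∈ S := by
    rcases hxR.1 with hx' | hx'
    · exact mem_of_conn_of_closed hclosed (Or.inl hhA) hx'
    · exact mem_of_conn_of_closed hclosed (Or.inl huA) hx'
  rcases hxS with h' | h'
  · exact absurd hx h'
  · exact h'

end Inside

section Base

variable {U : Set V} {ξ : Config E} {l h o u p : V}

omit [Fintype E] [DecidableEq E] in
/-- The canonical base is blue on every edge leaving the extended hull. -/
lemma coreBaseOf_bdry_blue {ζ : Config E}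
    (hdisj : ∀ x, x ∈ redExt ends h u ζ → x ∈ blueExt ends ζ h u → False)
    {e : E} {x y : V} (hxy : ends e = s(x, y)) (hxH : x ∈ extHull ends ζ h u)
    (hyH : y ∉ extHull ends ζ h u) : coreBaseOf ends ζ h u e = false := by
  have hyB : y ∉ blueExt ends ζ h u := fun h' => hyH (blueExt_subset_extHull h')
  rw [extHull_eq] at hxH
  rcases hxH with ((rfl | rfl) | hxR) | hxB
  · exfalso
    cases he : ζ e with
    | true => exact hyH (Or.inl (Or.inl (mem_cluster_of_edge (mem_cluster_self _ _ _) he hxy)))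
    | false =>
      have he' : blue ζ e = true := by rw [blue_eq_true_iff]; exact he
      exact hyH (Or.inl (Or.inr (mem_cluster_of_edge (mem_cluster_self _ _ _) he' hxy)))
  · exfalso
    cases he : ζ e with
    | true => exact hyH (Or.inr (Or.inl (mem_cluster_of_edge (mem_cluster_self _ _ _) he hxy)))
    | false =>
      have he' : blue ζ e = true := by rw [blue_eq_true_iff]; exact he
      exact hyH (Or.inr (Or.inr (mem_cluster_of_edge (mem_cluster_self _ _ _) he' hxy)))
  · rw [coreBaseOf_apply_of_notMem hxy (fun h' => hdisj x hxR h') hyB]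
    cases he : ζ e with
    | true => exact absurd (mem_extHull_of_red_of_mem_redExt hxy hxR he) hyH
    | false => rfl
  · rw [coreBaseOf_apply_of_mem hxy hxB]
    cases he : ζ e with
    | true => rfl
    | false =>
      exfalso
      have hxR' : x ∈ redExt ends h u (blue ζ) := by rw [redExt_blue]; exact hxB
      have he' : blue ζ e = true := by rw [blue_eq_true_iff]; exact he
      have := mem_extHull_of_red_of_mem_redExt hxy hxR' he'
      rw [extHull_blue] at this
      exact hyH this

omit [Fintype E] [DecidableEq E] in
/-- `p` lies in the extended hull (it is adjacent to `u`). -/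
lemma p_mem_extHull (hup : ∃ e, ends e = s(u, p)) (ζ : Config E) : p ∈ extHull ends ζ h u := by
  obtain ⟨e, he⟩ := hup
  cases hc : ζ e with
  | true => exact Or.inr (Or.inl (mem_cluster_of_edge (mem_cluster_self _ _ _) hc he))
  | false =>
    have hc' : blue ζ e = true := by rw [blue_eq_true_iff]; exact hc
    exact Or.inr (Or.inr (mem_cluster_of_edge (mem_cluster_self _ _ _) hc' he))

omit [DecidableEq E] in
/-- A u-arm is an arm other than the arm of `p`, adjacent to `u`. -/
lemma mem_uArms_iff {ζ : Config E} {P : Set V} :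
    P ∈ uArms ends h u p ζ ↔
      P ∈ armsC ends h u ζ ∧ P ≠ armC ends h u ζ p ∧ ∃ e x, ends e = s(u, x) ∧ x ∈ P := by
  simp only [uArms, Finset.mem_filter]

omit [DecidableEq E] in
/-- A far arm is an arm other than the arm of `p`, not adjacent to `u`. -/
lemma mem_farArms_iff {ζ : Config E} {P : Set V} :
    P ∈ farArms ends h u p ζ ↔
      P ∈ armsC ends h u ζ ∧ P ≠ armC ends h u ζ p ∧ ¬ ∃ e x, ends e = s(u, x) ∧ x ∈ P := by
  simp only [farArms, Finset.mem_filter]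

variable (hj : MixedJunction ends U h u p o)
include hj

omit [DecidableEq E] in
/-- The arm of `p` is an arm. -/
lemma armP_mem_armsC (ζ : Config E) : armC ends h u ζ p ∈ armsC ends h u ζ := by
  obtain ⟨e, he⟩ := hj.hup
  exact armC_mem_armsC hj.hne_hu (p_mem_extHull hj.hup ζ) hj.hne_hp.symm hj.hne_up.symm (Or.inr he)

omit [DecidableEq E] in
/-- A vertex of `H⁺ ∖ {h, u}` lies in the h-piece, is `p`, or lies in a u-arm or a far arm. -/
lemma arm_cases {ζ : Config E} {x : V} (hxH : x ∈ extHull ends ζ h u) (hxh : x ≠ h) (hxu : x ≠ u) :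
    x ∈ AhOf ends h u p ζ ∨ x = p ∨ (∃ P ∈ uArms ends h u p ζ, x ∈ P) ∨
      ∃ P ∈ farArms ends h u p ζ, x ∈ P := by
  obtain ⟨P, hP, hxP⟩ := exists_armsC_of_mem hj.hne_hu hxH hxh hxu
  by_cases hPp : P = armC ends h u ζ p
  · subst hPp
    by_cases hxp : x = p
    · exact Or.inr (Or.inl hxp)
    · exact Or.inl ⟨hxP, hxp⟩
  by_cases hadj : ∃ e y, ends e = s(u, y) ∧ y ∈ P
  · refine Or.inr (Or.inr (Or.inl ⟨P, ?_, hxP⟩))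
    simp only [uArms, Finset.mem_filter]
    exact ⟨hP, hPp, hadj⟩
  · refine Or.inr (Or.inr (Or.inr ⟨P, ?_, hxP⟩))
    simp only [farArms, Finset.mem_filter]
    exact ⟨hP, hPp, hadj⟩

omit [DecidableEq E] in
/-- A vertex of the union of all arms lies in the extended hull, and is neither `h` nor `u`. -/
lemma mem_extHull_of_mem_armsAll {ζ : Config E} {x : V}
    (hx : x ∈ armsAll (fun P : uArms ends h u p ζ => P.1) (AhOf ends h u p ζ)
      (fun P : farArms ends h u p ζ => P.1)) :
    x ∈ extHull ends ζ h u ∧ x ≠ h ∧ x ≠ u := by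
  rcases hx with (hx | hx) | hx
  · obtain ⟨P, hP⟩ := Set.mem_iUnion.1 hx
    exact armsC_subset (mem_uArms_iff.1 P.2).1 x hP
  · exact armsC_subset (armP_mem_armsC hj ζ) x hx.1
  · obtain ⟨P, hP⟩ := Set.mem_iUnion.1 hx
    exact armsC_subset (mem_farArms_iff.1 P.2).1 x hP

omit [Fintype E] [DecidableEq E] in
/-- No u-edge enters the arm of `p` except at `p` (when `H⁺ ⊆ U`). -/
lemma eq_p_of_u_edge {ζ : Config E} (hHU : extHull ends ζ h u ⊆ U) {e : E} {x : V}
    (he : ends e = s(u, x)) (hx : x ∈ armC ends h u ζ p) : x = p := by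
  by_contra hxp
  exact hj.hcomp x (armC_subset_compU hHU p hx) hxp e he

end Base

end BigBlock

end Summit.Ventures.PercRepro2
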